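import Mathlib
import HarnessLib
import Summits.AtomisticToContinuum.BoseEinsteinCondensation.Statement
import Summits.AtomisticToContinuum.BoseEinsteinCondensation.Theses.BlockLatticeFSum
import Summits.AtomisticToContinuum.BoseEinsteinCondensation.Theorems.DeepInfraredEmptinessShellInvSum
import Literature.MathematicalPhysics.QuantumManyBody.BoseGasThermodynamicLimitRuelle
import Literature.MathematicalPhysics.QuantumManyBody.BoseGasStructureFactor
import Literature.MathematicalPhysics.QuantumManyBody.PeriodicBoseGasThm31
import Literature.MathematicalPhysics.QuantumManyBody.LiebYngvasonPoincare
import Literature.MathematicalPhysics.QuantumManyBody.LiebYngvasonLowerBound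
import Literature.MathematicalPhysics.QuantumManyBody.PeriodicConfigFourier
import Literature.MathematicalPhysics.QuantumManyBody.PeriodicBoseGasUpperBoundProofs

/-!
# BlockLatticeFSum · residual `DeepInfraredEmptiness` (stmt-AtomisticToContinuum-27506) — THE RESPONSE COMPOSITION `A ∧ B ⟹ DeepPointwiseOne ⟹ route decl`
# (decomp-a2c lens-6 «barrier-complement carving», generations 22–24: §0–§3 of the node file `HyperuniformCarving.lean` (sha256 9fc319fe…),
# = g23 `ResponseCarving.lean` compositions; def-free tree twin landed by prover hand 1 (g7) at the critic's licence row 350 (3) —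
# the node file's `def`s `DeepPointwiseOne` / `DeepShellInvSum` / `DeepDensityFlatness` (A) / `LinearResponseGain` (B) are INLINED as
# hypothesis texts and the local copy of the route decl is replaced by the route decl BY NAME; proofs verbatim)

Line of record beneath the declared residual `DeepInfraredEmptiness` of route `BlockLatticeFSum`:
`DeepInfraredEmptiness ⟸ DeepPointwiseOne ∧ DeepShellInvSum` (g22; `DeepShellInvSum` = registered `stub_deepShellInvSum`, PROVED in the tree as
`…Cruxes.DeepInfraredEmptiness.InvSumDF.deepShellInvSum`, module `Theorems.DeepInfraredEmptinessShellInvSum`) and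
`DeepPointwiseOne ⟸ DeepDensityFlatness (A, diagonal: N-uniformly bounded structure factor of periodic near-minimisers on the deepest wavevectors)
∧ LinearResponseGain (B, off-diagonal residual: block-wave occupation ≤ kinetic gain × (1 + structure factor at the centred wavevector))` (g23).

* lattice lemmas on the centred representative `q̃_j ∈ (−K/2, K/2]` of a block wavevector (`crep_abs`, `crep_eq_zero`, `eps_nonneg`, `crep_sq_le_eps`);
* `deepPointwiseOne_of_flatness_gain` — A ∧ B ⟹ `DeepPointwiseOne` (registered stub text of `stub_deepPointwiseOne`, skeleton 6417f3f1, verbatim);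
* `linearResponseGain_of_deepPointwiseOne` — certificate that B is WEAKER than the target;
* `DeepInfraredEmptiness_of` — `DeepPointwiseOne → DeepShellInvSum → BlockLatticeFSum.DeepInfraredEmptiness` (route decl BY NAME; density threshold
  `8·C·C₀·θ·√ρ ≤ A³`); `deepInfraredEmptiness_of_flatness_gain` — A → B → route decl.
All `[folklore]` bookkeeping; no definitions; 0 sorry.
-/

noncomputable section

namespace Summit.AtomisticToContinuum.BoseEinsteinCondensation.Theorems.DeepInfraredEmptinessResponseComposition

open Filter
open scoped ENNReal

/-! ## Lattice lemmas: the centred representative `q̃_j ∈ (-K/2, K/2]` of a block wavevector -/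

/-- `|q̃| = min(n, K − n)` for the centred representative `q̃ ∈ (−K/2, K/2]` of `n mod K`. [folklore] -/
theorem crep_abs (K : ℕ) (n : Fin K) :
    |(((if 2 * (n : ℕ) ≤ K then (((n : ℕ) : ℤ)) else (((n : ℕ) : ℤ) - (K : ℤ))) : ℤ) : ℝ)| =
      ((min n.val (K - n.val) : ℕ) : ℝ) := by
  have hn : n.val < K := n.isLt
  split_ifs with h
  · rw [min_eq_left (by omega)]
    push_cast
    exact abs_of_nonneg (Nat.cast_nonneg _)
  · rw [min_eq_right (by omega)]
    push_cast
    rw [Nat.cast_sub hn.le]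
    have : ((n : ℕ) : ℝ) < (K : ℝ) := by exact_mod_cast hn
    rw [abs_of_neg (by linarith)]
    ring

/-- the centred representative vanishes only at `n = 0`. [folklore] -/
theorem crep_eq_zero (K : ℕ) (n : Fin K)
    (h : (if 2 * (n : ℕ) ≤ K then (((n : ℕ) : ℤ)) else (((n : ℕ) : ℤ) - (K : ℤ))) = 0) : (n : ℕ) = 0 := by
  have hn : n.val < K := n.isLt
  split_ifs at h with h2
  · exact_mod_cast h
  · omega

/-- the block dispersion `ε(q) = Σ_j (1 − cos(2π q_j/K))` is nonnegative. [folklore] -/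
theorem eps_nonneg (K : ℕ) (q : Fin 3 → Fin K) :
    0 ≤ (∑ j : Fin 3, (1 - Real.cos (2 * Real.pi * ((q j : ℕ) : ℝ) / (K : ℝ)))) :=
  Finset.sum_nonneg fun _ _ => sub_nonneg.2 (Real.cos_le_one _)

/-- one coordinate of the dispersion is below the whole: `8 q̃_j²/K² ≤ 1 - cos(2π q_j/K) ≤ ε(q)`. -/
theorem crep_sq_le_eps (K : ℕ) (hK : 0 < K) (q : Fin 3 → Fin K) (j : Fin 3) :
    (8 : ℝ) * (|(((if 2 * (q j : ℕ) ≤ K then (((q j : ℕ) : ℤ)) else (((q j : ℕ) : ℤ) - (K : ℤ))) : ℤ) : ℝ)|) ^ 2 / (K : ℝ) ^ 2 ≤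
      (∑ j : Fin 3, (1 - Real.cos (2 * Real.pi * ((q j : ℕ) : ℝ) / (K : ℝ)))) := by
  rw [crep_abs]
  refine (Summit.AtomisticToContinuum.BoseEinsteinCondensation.Cruxes.DeepInfraredEmptiness.InvSumDF.jordan_cdist K hK (q j)).trans ?_
  exact Finset.single_le_sum (f := fun i : Fin 3 => 1 - Real.cos (2 * Real.pi * ((q i : ℕ) : ℝ) / (K : ℝ)))
    (fun i _ => sub_nonneg.2 (Real.cos_le_one _)) (Finset.mem_univ j)


/-! ## The composition `A ∧ B ⟹ target` (real proof) -/

/-- **A ∧ B ⟹ the registered core stub `stub_deepPointwiseOne`** (texts inlined; real proof: the centred wavevector of a deep block wave lies in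
A's window, so B's factor `1 + S/N` is at most `1 + σ`). [folklore] -/
theorem deepPointwiseOne_of_flatness_gain (hA : (∀ v : ℝ → ENNReal, Literature.MathematicalPhysics.QuantumManyBody.BoseGas.IsRepulsiveFiniteRange v → ∃ κ : ℝ, 0 < κ ∧ ∃ σ : ℝ, 0 < σ ∧ ∃ ρ₀ : ℝ, 0 < ρ₀ ∧ ∀ ρ : ℝ, 0 < ρ → ρ < ρ₀ → ∀ᶠ N : ℕ in Filter.atTop, ∃ δ : ENNReal, 0 < δ ∧ ∀ Ψ : Literature.MathematicalPhysics.QuantumManyBody.BoseGas.PeriodicTrialState N (Literature.MathematicalPhysics.QuantumManyBody.BoseGas.sideLength ρ N), Literature.MathematicalPhysics.QuantumManyBody.BoseGas.periodicEnergy v Ψ ≤ Literature.MathematicalPhysics.QuantumManyBody.BoseGas.periodicGroundStateEnergy v N (Literature.MathematicalPhysics.QuantumManyBody.BoseGas.sideLength ρ N) + δ → ∀ m : Fin 3 → ℤ, m ≠ 0 → (∀ j : Fin 3, |((m j : ℤ) : ℝ)| ≤ κ * Real.sqrt ρ * Literature.MathematicalPhysics.QuantumManyBody.BoseGas.sideLength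 ρ N) → Literature.MathematicalPhysics.QuantumManyBody.BoseGas.structureFactorVar N (Literature.MathematicalPhysics.QuantumManyBody.BoseGas.sideLength ρ N) ((Literature.MathematicalPhysics.QuantumManyBody.BoseGas.cellN N (Literature.MathematicalPhysics.QuantumManyBody.BoseGas.sideLength ρ N)).indicator Ψ.ψ) m ≤ ENNReal.ofReal σ * (N : ENNReal))) (hB : (∀ v : ℝ → ENNReal, Literature.MathematicalPhysics.QuantumManyBody.BoseGas.IsRepulsiveFiniteRange v → ∃ A : ℝ, 0 < A ∧ ∃ θ : ℝ, 0 < θ ∧ ∃ C : ℝ, 0 < C ∧ ∃ ρ₀ : ℝ, 0 < ρ₀ ∧ ∀ ρ : ℝ, 0 < ρ → ρ < ρ₀ → ∀ᶠ N : ℕ in Filter.atTop, ∃ δ : ENNReal, 0 < δ ∧ ∀ Ψ : Literature.MathematicalPhysics.QuantumManyBody.BoseGas.PeriodicTrialState N (Literature.MathematicalPhysics.QuantumManyBody.BoseGas.sideLength ρ N), Literature.MathematicalPhysics.QuantumManyBody.BoseGas.periodicEnergy v Ψ ≤ Literature.MathematicalPhysics.QuantumManyBody.BoseGas.periodicGroundStateEnergy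 v N (Literature.MathematicalPhysics.QuantumManyBody.BoseGas.sideLength ρ N) + δ → ∀ K : ℕ, Even K → 0 < K → A / Real.sqrt ρ ≤ Literature.MathematicalPhysics.QuantumManyBody.BoseGas.sideLength ρ N / (K : ℝ) ∧ Literature.MathematicalPhysics.QuantumManyBody.BoseGas.sideLength ρ N / (K : ℝ) ≤ 2 * A / Real.sqrt ρ → ∀ q ∈ (Finset.univ.filter fun q : Fin 3 → Fin K => ¬ (∀ j : Fin 3, (q j : ℕ) = 0) ∧ (∑ j : Fin 3, (1 - Real.cos (2 * Real.pi * ((q j : ℕ) : ℝ) / (K : ℝ)))) < θ), Literature.MathematicalPhysics.QuantumManyBody.BoseGas.cellOccupation N (Literature.MathematicalPhysics.QuantumManyBody.BoseGas.sideLength ρ N) (fun x : EuclideanSpace ℝ (Fin 3) => (((Real.sqrt (Literature.MathematicalPhysics.QuantumManyBody.BoseGas.sideLength ρ N ^ 3))⁻¹ : ℝ) : ℂ) * Complex.exp (((2 * Real.pi * (∑ j : Fin 3, ((q j : ℕ) : ℝ) * (⌊(K : ℝ) * x j / Literature.MathematicalPhysics.QuantumManyBody.BoseGas.sideLength ρ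 N⌋ : ℝ)) / (K : ℝ) : ℝ) : ℂ) * Complex.I)) Ψ.ψ ≤ ENNReal.ofReal (C / (∑ j : Fin 3, (1 - Real.cos (2 * Real.pi * ((q j : ℕ) : ℝ) / (K : ℝ))))) * (1 + Literature.MathematicalPhysics.QuantumManyBody.BoseGas.structureFactorVar N (Literature.MathematicalPhysics.QuantumManyBody.BoseGas.sideLength ρ N) ((Literature.MathematicalPhysics.QuantumManyBody.BoseGas.cellN N (Literature.MathematicalPhysics.QuantumManyBody.BoseGas.sideLength ρ N)).indicator Ψ.ψ) (fun j : Fin 3 => if 2 * (q j : ℕ) ≤ K then (((q j : ℕ) : ℤ)) else (((q j : ℕ) : ℤ) - (K : ℤ))) / (N : ENNReal)))) :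
    (∀ v : ℝ → ENNReal, Literature.MathematicalPhysics.QuantumManyBody.BoseGas.IsRepulsiveFiniteRange v → ∃ A : ℝ, 0 < A ∧ ∃ θ : ℝ, 0 < θ ∧ ∃ C : ℝ, 0 < C ∧ ∃ ρ₀ : ℝ, 0 < ρ₀ ∧ ∀ ρ : ℝ, 0 < ρ → ρ < ρ₀ → ∀ᶠ N : ℕ in Filter.atTop, ∃ δ : ENNReal, 0 < δ ∧ ∀ Ψ : Literature.MathematicalPhysics.QuantumManyBody.BoseGas.PeriodicTrialState N (Literature.MathematicalPhysics.QuantumManyBody.BoseGas.sideLength ρ N), Literature.MathematicalPhysics.QuantumManyBody.BoseGas.periodicEnergy v Ψ ≤ Literature.MathematicalPhysics.QuantumManyBody.BoseGas.periodicGroundStateEnergy v N (Literature.MathematicalPhysics.QuantumManyBody.BoseGas.sideLength ρ N) + δ → ∀ K : ℕ, Even K → 0 < K → A / Real.sqrt ρ ≤ Literature.MathematicalPhysics.QuantumManyBody.BoseGas.sideLength ρ N / (K : ℝ) ∧ Literature.MathematicalPhysics.QuantumManyBody.BoseGas.sideLength ρ N / (K : ℝ) ≤ 2 * A / Real.sqrt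 ρ → ∀ q ∈ (Finset.univ.filter fun q : Fin 3 → Fin K => ¬ (∀ j : Fin 3, (q j : ℕ) = 0) ∧ (∑ j : Fin 3, (1 - Real.cos (2 * Real.pi * ((q j : ℕ) : ℝ) / (K : ℝ)))) < θ), Literature.MathematicalPhysics.QuantumManyBody.BoseGas.cellOccupation N (Literature.MathematicalPhysics.QuantumManyBody.BoseGas.sideLength ρ N) (fun x : EuclideanSpace ℝ (Fin 3) => (((Real.sqrt (Literature.MathematicalPhysics.QuantumManyBody.BoseGas.sideLength ρ N ^ 3))⁻¹ : ℝ) : ℂ) * Complex.exp (((2 * Real.pi * (∑ j : Fin 3, ((q j : ℕ) : ℝ) * (⌊(K : ℝ) * x j / Literature.MathematicalPhysics.QuantumManyBody.BoseGas.sideLength ρ N⌋ : ℝ)) / (K : ℝ) : ℝ) : ℂ) * Complex.I)) Ψ.ψ ≤ ENNReal.ofReal (C / (∑ j : Fin 3, (1 - Real.cos (2 * Real.pi * ((q j : ℕ) : ℝ) / (K : ℝ)))))) := by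
  intro v hv
  obtain ⟨κ, hκ, σ, hσ, ρA, hρA, HA⟩ := hA v hv
  obtain ⟨A, hA0, θB, hθB, CG, hCG, ρB, hρB, HB⟩ := hB v hv
  refine ⟨A, hA0, min θB (8 * κ ^ 2 * A ^ 2), lt_min hθB (by positivity), CG * (1 + σ), by positivity,
    min ρA ρB, lt_min hρA hρB, fun ρ hρ hρlt => ?_⟩
  have hρ1 : ρ < ρA := lt_of_lt_of_le hρlt (min_le_left _ _)
  have hρ2 : ρ < ρB := lt_of_lt_of_le hρlt (min_le_right _ _)
  filter_upwards [HA ρ hρ hρ1, HB ρ hρ hρ2, eventually_gt_atTop 0] with N hNA hNB hNpos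
  obtain ⟨δA, hδA, HA'⟩ := hNA
  obtain ⟨δB, hδB, HB'⟩ := hNB
  refine ⟨min δA δB, lt_min hδA hδB, fun Ψ hE K hKe hK hwin q hq => ?_⟩
  have hEA : Literature.MathematicalPhysics.QuantumManyBody.BoseGas.periodicEnergy v Ψ ≤ Literature.MathematicalPhysics.QuantumManyBody.BoseGas.periodicGroundStateEnergy v N (Literature.MathematicalPhysics.QuantumManyBody.BoseGas.sideLength ρ N) + δA :=
    hE.trans (add_le_add le_rfl (min_le_left _ _))
  have hEB : Literature.MathematicalPhysics.QuantumManyBody.BoseGas.periodicEnergy v Ψ ≤ Literature.MathematicalPhysics.QuantumManyBody.BoseGas.periodicGroundStateEnergy v N (Literature.MathematicalPhysics.QuantumManyBody.BoseGas.sideLength ρ N) + δB :=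
    hE.trans (add_le_add le_rfl (min_le_right _ _))
  rw [Finset.mem_filter] at hq
  obtain ⟨-, hq0, hqε⟩ := hq
  -- B at the deeper shell `θ ≤ θB`
  have hqB : q ∈ (Finset.univ.filter fun q : Fin 3 → Fin K => ¬ (∀ j : Fin 3, (q j : ℕ) = 0) ∧ (∑ j : Fin 3, (1 - Real.cos (2 * Real.pi * ((q j : ℕ) : ℝ) / (K : ℝ)))) < θB) := by
    rw [Finset.mem_filter]
    exact ⟨Finset.mem_univ _, hq0, hqε.trans_le (min_le_left _ _)⟩
  have hgain := HB' Ψ hEB K hKe hK hwin q hqB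
  -- the centred representative `m = q̃`
  set m : Fin 3 → ℤ := (fun j : Fin 3 => if 2 * (q j : ℕ) ≤ K then (((q j : ℕ) : ℤ)) else (((q j : ℕ) : ℤ) - (K : ℤ))) with hm
  have hm0 : m ≠ 0 := by
    intro h0
    apply hq0
    intro j
    have hj : m j = 0 := by rw [h0]; rfl
    exact crep_eq_zero K (q j) hj
  -- window: `A K ≤ L √ρ`
  have hKr : (0 : ℝ) < (K : ℝ) := Nat.cast_pos.2 hK
  have hsρ : 0 < Real.sqrt ρ := Real.sqrt_pos.2 hρ
  have hw : A * (K : ℝ) ≤ Literature.MathematicalPhysics.QuantumManyBody.BoseGas.sideLength ρ N * Real.sqrt ρ := by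
    have := hwin.1
    rwa [div_le_div_iff₀ hsρ hKr] at this
  -- `|m_j| ≤ κ √ρ L`
  have hmj : ∀ j : Fin 3, |((m j : ℤ) : ℝ)| ≤ κ * Real.sqrt ρ * Literature.MathematicalPhysics.QuantumManyBody.BoseGas.sideLength ρ N := by
    intro j
    have h8 := crep_sq_le_eps K hK q j
    have hlt : (8 : ℝ) * (|((m j : ℤ) : ℝ)|) ^ 2 / (K : ℝ) ^ 2 < 8 * κ ^ 2 * A ^ 2 :=
      (h8.trans_lt hqε).trans_le (min_le_right _ _)
    have hK2 : (0 : ℝ) < (K : ℝ) ^ 2 := by positivity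
    rw [div_lt_iff₀ hK2] at hlt
    have hsq : (|((m j : ℤ) : ℝ)|) ^ 2 ≤ (κ * A * (K : ℝ)) ^ 2 := by nlinarith
    have habs : |((m j : ℤ) : ℝ)| ≤ κ * A * (K : ℝ) :=
      (sq_le_sq₀ (abs_nonneg _) (by positivity)).1 hsq
    calc |((m j : ℤ) : ℝ)| ≤ κ * A * (K : ℝ) := habs
      _ = κ * (A * (K : ℝ)) := by ring
      _ ≤ κ * (Literature.MathematicalPhysics.QuantumManyBody.BoseGas.sideLength ρ N * Real.sqrt ρ) := mul_le_mul_of_nonneg_left hw hκ.le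
      _ = κ * Real.sqrt ρ * Literature.MathematicalPhysics.QuantumManyBody.BoseGas.sideLength ρ N := by ring
  have hflat := HA' Ψ hEA m hm0 hmj
  -- ENNReal arithmetic
  have h1 : Literature.MathematicalPhysics.QuantumManyBody.BoseGas.structureFactorVar N (Literature.MathematicalPhysics.QuantumManyBody.BoseGas.sideLength ρ N) ((Literature.MathematicalPhysics.QuantumManyBody.BoseGas.cellN N (Literature.MathematicalPhysics.QuantumManyBody.BoseGas.sideLength ρ N)).indicator Ψ.ψ) m / (N : ENNReal) ≤ ENNReal.ofReal σ :=
    ENNReal.div_le_of_le_mul hflat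
  have h2 := hgain.trans (mul_le_mul' le_rfl (add_le_add le_rfl h1))
  refine h2.trans (le_of_eq ?_)
  rw [← ENNReal.ofReal_one, ← ENNReal.ofReal_add zero_le_one hσ.le,
    ← ENNReal.ofReal_mul (div_nonneg hCG.le (eps_nonneg K q))]
  congr 1
  rw [div_mul_eq_mul_div]

/-! ## Certificate: piece B is (strictly) WEAKER than the target -/

/-- **certificate: piece B is WEAKER than the target** (`DeepPointwiseOne → LinearResponseGain`, texts inlined). [folklore] -/
theorem linearResponseGain_of_deepPointwiseOne (h : (∀ v : ℝ → ENNReal, Literature.MathematicalPhysics.QuantumManyBody.BoseGas.IsRepulsiveFiniteRange v → ∃ A : ℝ, 0 < A ∧ ∃ θ : ℝ, 0 < θ ∧ ∃ C : ℝ, 0 < C ∧ ∃ ρ₀ : ℝ, 0 < ρ₀ ∧ ∀ ρ : ℝ, 0 < ρ → ρ < ρ₀ → ∀ᶠ N : ℕ in Filter.atTop, ∃ δ : ENNReal, 0 < δ ∧ ∀ Ψ : Literature.MathematicalPhysics.QuantumManyBody.BoseGas.PeriodicTrialState N (Literature.MathematicalPhysics.QuantumManyBody.BoseGas.sideLength ρ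 N), Literature.MathematicalPhysics.QuantumManyBody.BoseGas.periodicEnergy v Ψ ≤ Literature.MathematicalPhysics.QuantumManyBody.BoseGas.periodicGroundStateEnergy v N (Literature.MathematicalPhysics.QuantumManyBody.BoseGas.sideLength ρ N) + δ → ∀ K : ℕ, Even K → 0 < K → A / Real.sqrt ρ ≤ Literature.MathematicalPhysics.QuantumManyBody.BoseGas.sideLength ρ N / (K : ℝ) ∧ Literature.MathematicalPhysics.QuantumManyBody.BoseGas.sideLength ρ N / (K : ℝ) ≤ 2 * A / Real.sqrt ρ → ∀ q ∈ (Finset.univ.filter fun q : Fin 3 → Fin K => ¬ (∀ j : Fin 3, (q j : ℕ) = 0) ∧ (∑ j : Fin 3, (1 - Real.cos (2 * Real.pi * ((q j : ℕ) : ℝ) / (K : ℝ)))) < θ), Literature.MathematicalPhysics.QuantumManyBody.BoseGas.cellOccupation N (Literature.MathematicalPhysics.QuantumManyBody.BoseGas.sideLength ρ N) (fun x : EuclideanSpace ℝ (Fin 3) => (((Real.sqrt (Literature.MathematicalPhysics.QuantumManyBody.BoseGas.sideLength ρ N ^ 3))⁻¹ : ℝ) : ℂ) * Complex.exp (((2 *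 Real.pi * (∑ j : Fin 3, ((q j : ℕ) : ℝ) * (⌊(K : ℝ) * x j / Literature.MathematicalPhysics.QuantumManyBody.BoseGas.sideLength ρ N⌋ : ℝ)) / (K : ℝ) : ℝ) : ℂ) * Complex.I)) Ψ.ψ ≤ ENNReal.ofReal (C / (∑ j : Fin 3, (1 - Real.cos (2 * Real.pi * ((q j : ℕ) : ℝ) / (K : ℝ))))))) : (∀ v : ℝ → ENNReal, Literature.MathematicalPhysics.QuantumManyBody.BoseGas.IsRepulsiveFiniteRange v → ∃ A : ℝ, 0 < A ∧ ∃ θ : ℝ, 0 < θ ∧ ∃ C : ℝ, 0 < C ∧ ∃ ρ₀ : ℝ, 0 < ρ₀ ∧ ∀ ρ : ℝ, 0 < ρ → ρ < ρ₀ → ∀ᶠ N : ℕ in Filter.atTop, ∃ δ : ENNReal, 0 < δ ∧ ∀ Ψ : Literature.MathematicalPhysics.QuantumManyBody.BoseGas.PeriodicTrialState N (Literature.MathematicalPhysics.QuantumManyBody.BoseGas.sideLength ρ N), Literature.MathematicalPhysics.QuantumManyBody.BoseGas.periodicEnergy v Ψ ≤ Literature.MathematicalPhysics.QuantumManyBody.BoseGas.periodicGroundStateEnergy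 v N (Literature.MathematicalPhysics.QuantumManyBody.BoseGas.sideLength ρ N) + δ → ∀ K : ℕ, Even K → 0 < K → A / Real.sqrt ρ ≤ Literature.MathematicalPhysics.QuantumManyBody.BoseGas.sideLength ρ N / (K : ℝ) ∧ Literature.MathematicalPhysics.QuantumManyBody.BoseGas.sideLength ρ N / (K : ℝ) ≤ 2 * A / Real.sqrt ρ → ∀ q ∈ (Finset.univ.filter fun q : Fin 3 → Fin K => ¬ (∀ j : Fin 3, (q j : ℕ) = 0) ∧ (∑ j : Fin 3, (1 - Real.cos (2 * Real.pi * ((q j : ℕ) : ℝ) / (K : ℝ)))) < θ), Literature.MathematicalPhysics.QuantumManyBody.BoseGas.cellOccupation N (Literature.MathematicalPhysics.QuantumManyBody.BoseGas.sideLength ρ N) (fun x : EuclideanSpace ℝ (Fin 3) => (((Real.sqrt (Literature.MathematicalPhysics.QuantumManyBody.BoseGas.sideLength ρ N ^ 3))⁻¹ : ℝ) : ℂ) * Complex.exp (((2 * Real.pi * (∑ j : Fin 3, ((q j : ℕ) : ℝ) * (⌊(K : ℝ) * x j / Literature.MathematicalPhysics.QuantumManyBody.BoseGas.sideLength ρ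 N⌋ : ℝ)) / (K : ℝ) : ℝ) : ℂ) * Complex.I)) Ψ.ψ ≤ ENNReal.ofReal (C / (∑ j : Fin 3, (1 - Real.cos (2 * Real.pi * ((q j : ℕ) : ℝ) / (K : ℝ))))) * (1 + Literature.MathematicalPhysics.QuantumManyBody.BoseGas.structureFactorVar N (Literature.MathematicalPhysics.QuantumManyBody.BoseGas.sideLength ρ N) ((Literature.MathematicalPhysics.QuantumManyBody.BoseGas.cellN N (Literature.MathematicalPhysics.QuantumManyBody.BoseGas.sideLength ρ N)).indicator Ψ.ψ) (fun j : Fin 3 => if 2 * (q j : ℕ) ≤ K then (((q j : ℕ) : ℤ)) else (((q j : ℕ) : ℤ) - (K : ℤ))) / (N : ENNReal))) := by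
  intro v hv
  obtain ⟨A, hA, θ, hθ, C, hC, ρ₀, hρ₀, H⟩ := h v hv
  refine ⟨A, hA, θ, hθ, C, hC, ρ₀, hρ₀, fun ρ hρ hρlt => ?_⟩
  filter_upwards [H ρ hρ hρlt] with N hN
  obtain ⟨δ, hδ, H'⟩ := hN
  refine ⟨δ, hδ, fun Ψ hE K hKe hK hwin q hq => ?_⟩
  exact (H' Ψ hE K hKe hK hwin q hq).trans (le_mul_of_one_le_right' le_self_add)

/-! ## Down to the route decl (g22's composition verbatim + the landed lattice sum) -/

/-- the composition (real proof): pointwise deep bound + lattice sum ⇒ the occupation budget `N/8`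
on the deep shell, for `ρ` small (`8·C·C₀·θ·√ρ ≤ A³`). -/
theorem DeepInfraredEmptiness_of : (∀ v : ℝ → ENNReal, Literature.MathematicalPhysics.QuantumManyBody.BoseGas.IsRepulsiveFiniteRange v → ∃ A : ℝ, 0 < A ∧ ∃ θ : ℝ, 0 < θ ∧ ∃ C : ℝ, 0 < C ∧ ∃ ρ₀ : ℝ, 0 < ρ₀ ∧ ∀ ρ : ℝ, 0 < ρ → ρ < ρ₀ → ∀ᶠ N : ℕ in Filter.atTop, ∃ δ : ENNReal, 0 < δ ∧ ∀ Ψ : Literature.MathematicalPhysics.QuantumManyBody.BoseGas.PeriodicTrialState N (Literature.MathematicalPhysics.QuantumManyBody.BoseGas.sideLength ρ N), Literature.MathematicalPhysics.QuantumManyBody.BoseGas.periodicEnergy v Ψ ≤ Literature.MathematicalPhysics.QuantumManyBody.BoseGas.periodicGroundStateEnergy v N (Literature.MathematicalPhysics.QuantumManyBody.BoseGas.sideLength ρ N) + δ → ∀ K : ℕ, Even K → 0 < K → A / Real.sqrt ρ ≤ Literature.MathematicalPhysics.QuantumManyBody.BoseGas.sideLength ρ N / (K : ℝ) ∧ Literature.MathematicalPhysics.QuantumManyBody.BoseGas.sideLength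 ρ N / (K : ℝ) ≤ 2 * A / Real.sqrt ρ → ∀ q ∈ (Finset.univ.filter fun q : Fin 3 → Fin K => ¬ (∀ j : Fin 3, (q j : ℕ) = 0) ∧ (∑ j : Fin 3, (1 - Real.cos (2 * Real.pi * ((q j : ℕ) : ℝ) / (K : ℝ)))) < θ), Literature.MathematicalPhysics.QuantumManyBody.BoseGas.cellOccupation N (Literature.MathematicalPhysics.QuantumManyBody.BoseGas.sideLength ρ N) (fun x : EuclideanSpace ℝ (Fin 3) => (((Real.sqrt (Literature.MathematicalPhysics.QuantumManyBody.BoseGas.sideLength ρ N ^ 3))⁻¹ : ℝ) : ℂ) * Complex.exp (((2 * Real.pi * (∑ j : Fin 3, ((q j : ℕ) : ℝ) * (⌊(K : ℝ) * x j / Literature.MathematicalPhysics.QuantumManyBody.BoseGas.sideLength ρ N⌋ : ℝ)) / (K : ℝ) : ℝ) : ℂ) * Complex.I)) Ψ.ψ ≤ ENNReal.ofReal (C / (∑ j : Fin 3, (1 - Real.cos (2 * Real.pi * ((q j : ℕ) : ℝ) / (K : ℝ)))))) → (∃ C₀ : ℝ, 0 < C₀ ∧ ∀ K : ℕ, 0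 < K → ∀ θ : ℝ, 0 < θ → (∑ q ∈ (Finset.univ.filter fun q : Fin 3 → Fin K => ¬ (∀ j : Fin 3, (q j : ℕ) = 0) ∧ (∑ j : Fin 3, (1 - Real.cos (2 * Real.pi * ((q j : ℕ) : ℝ) / (K : ℝ)))) < θ), 1 / (∑ j : Fin 3, (1 - Real.cos (2 * Real.pi * ((q j : ℕ) : ℝ) / (K : ℝ))))) ≤ C₀ * Real.sqrt θ * (K : ℝ) ^ 3) → Summit.AtomisticToContinuum.BoseEinsteinCondensation.Theses.BlockLatticeFSum.DeepInfraredEmptiness := by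
  intro h1 h2 v hv
  obtain ⟨A, hA, θ, hθ, C, hC, ρ₀, hρ₀, H⟩ := h1 v hv
  obtain ⟨C₀, hC₀, HS⟩ := h2
  -- density threshold: √ρ < A³/(8 C C₀ θ)
  set r : ℝ := A ^ 3 / (8 * C * C₀ * Real.sqrt θ) with hr
  have hrpos : 0 < r := by rw [hr]; positivity
  refine ⟨A, hA, θ, hθ, min ρ₀ (r ^ 2), lt_min hρ₀ (by positivity), fun ρ hρ hρlt => ?_⟩
  have hρ₁ : ρ < ρ₀ := lt_of_lt_of_le hρlt (min_le_left _ _)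
  have hρr : Real.sqrt ρ < r := by
    rw [Real.sqrt_lt' hrpos]
    exact lt_of_lt_of_le hρlt (min_le_right _ _)
  filter_upwards [H ρ hρ hρ₁, eventually_gt_atTop 0] with N hN hNpos
  obtain ⟨δ, hδ, hΨ⟩ := hN
  refine ⟨δ, hδ, fun Ψ hE K hK hKpos hwin => ?_⟩
  -- step 1: pointwise bound inside the sum
  have step1 := Finset.sum_le_sum (hΨ Ψ hE K hK hKpos hwin)
  refine step1.trans ?_
  -- step 2: pull `ofReal` out of the sum
  rw [← ENNReal.ofReal_sum_of_nonneg (fun q _ => div_nonneg hC.le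
    (Finset.sum_nonneg fun j _ => sub_nonneg.2 (Real.cos_le_one _)))]
  apply ENNReal.ofReal_le_ofReal
  -- step 3: the lattice sum
  have hsum := HS K hKpos θ hθ
  have hCsum : (∑ q ∈ (Finset.univ.filter fun q : Fin 3 → Fin K => ¬ (∀ j : Fin 3, (q j : ℕ) = 0) ∧ (∑ j : Fin 3, (1 - Real.cos (2 * Real.pi * ((q j : ℕ) : ℝ) / (K : ℝ)))) < θ), C / (∑ j : Fin 3, (1 - Real.cos (2 * Real.pi * ((q j : ℕ) : ℝ) / (K : ℝ)))))
      = C * ∑ q ∈ (Finset.univ.filter fun q : Fin 3 → Fin K => ¬ (∀ j : Fin 3, (q j : ℕ) = 0) ∧ (∑ j : Fin 3, (1 - Real.cos (2 * Real.pi * ((q j : ℕ) : ℝ) / (K : ℝ)))) < θ), 1 / (∑ j : Fin 3, (1 - Real.cos (2 * Real.pi * ((q j : ℕ) : ℝ) / (K : ℝ)))) := by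
    rw [Finset.mul_sum]
    refine Finset.sum_congr rfl fun q _ => ?_
    ring
  rw [hCsum]
  -- step 4: K³ ≤ N √ρ / A³ from the window and L³ = N/ρ
  have hL : 0 < Literature.MathematicalPhysics.QuantumManyBody.BoseGas.sideLength ρ N :=
    Real.rpow_pos_of_pos (div_pos (Nat.cast_pos.2 hNpos) hρ) _
  have hKr : (0 : ℝ) < (K : ℝ) := Nat.cast_pos.2 hKpos
  have hsρ : 0 < Real.sqrt ρ := Real.sqrt_pos.2 hρ
  have hw : A * (K : ℝ) ≤ Literature.MathematicalPhysics.QuantumManyBody.BoseGas.sideLength ρ N * Real.sqrt ρ := by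
    have := hwin.1
    rwa [div_le_div_iff₀ hsρ hKr] at this
  have hL3 : Literature.MathematicalPhysics.QuantumManyBody.BoseGas.sideLength ρ N ^ 3 = (N : ℝ) / ρ :=
    Literature.MathematicalPhysics.QuantumManyBody.BoseGas.sideLength_pow_three hρ N
  have hs3 : Real.sqrt ρ ^ 3 = ρ * Real.sqrt ρ := by
    rw [pow_succ, Real.sq_sqrt hρ.le]
  have hAK : A ^ 3 * (K : ℝ) ^ 3 ≤ (N : ℝ) * Real.sqrt ρ := by
    have h3 : (A * (K : ℝ)) ^ 3 ≤ (Literature.MathematicalPhysics.QuantumManyBody.BoseGas.sideLength ρ N * Real.sqrt ρ) ^ 3 :=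
      pow_le_pow_left₀ (by positivity) hw 3
    rw [mul_pow, mul_pow, hL3, hs3] at h3
    have : (N : ℝ) / ρ * (ρ * Real.sqrt ρ) = (N : ℝ) * Real.sqrt ρ := by
      field_simp
    linarith [h3, this.symm.le, this.le]
  -- step 5: arithmetic `C (C₀ θ K³) ≤ N/8`
  have hsθ : 0 < Real.sqrt θ := Real.sqrt_pos.2 hθ
  have hρr' : 8 * C * C₀ * Real.sqrt θ * Real.sqrt ρ ≤ A ^ 3 := by
    have : Real.sqrt ρ ≤ A ^ 3 / (8 * C * C₀ * Real.sqrt θ) := hρr.le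
    rwa [le_div_iff₀ (by positivity), mul_comm] at this
  have hA3 : 0 < A ^ 3 := by positivity
  have key : C * (C₀ * Real.sqrt θ * (K : ℝ) ^ 3) * A ^ 3 ≤ (N : ℝ) / 8 * A ^ 3 := by
    have e1 : C * (C₀ * Real.sqrt θ * (K : ℝ) ^ 3) * A ^ 3 = (C * C₀ * Real.sqrt θ) * (A ^ 3 * (K : ℝ) ^ 3) := by ring
    rw [e1]
    calc C * C₀ * Real.sqrt θ * (A ^ 3 * (K : ℝ) ^ 3)
        ≤ C * C₀ * Real.sqrt θ * ((N : ℝ) * Real.sqrt ρ) :=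
          mul_le_mul_of_nonneg_left hAK (by positivity)
      _ = (N : ℝ) * (C * C₀ * Real.sqrt θ * Real.sqrt ρ) := by ring
      _ ≤ (N : ℝ) * (A ^ 3 / 8) := by
          apply mul_le_mul_of_nonneg_left _ (Nat.cast_nonneg N)
          linarith
      _ = (N : ℝ) / 8 * A ^ 3 := by ring
  calc C * ∑ q ∈ (Finset.univ.filter fun q : Fin 3 → Fin K => ¬ (∀ j : Fin 3, (q j : ℕ) = 0) ∧ (∑ j : Fin 3, (1 - Real.cos (2 * Real.pi * ((q j : ℕ) : ℝ) / (K : ℝ)))) < θ), 1 / (∑ j : Fin 3, (1 - Real.cos (2 * Real.pi * ((q j : ℕ) : ℝ) / (K : ℝ))))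
      ≤ C * (C₀ * Real.sqrt θ * (K : ℝ) ^ 3) := mul_le_mul_of_nonneg_left hsum hC.le
    _ ≤ (N : ℝ) / 8 := le_of_mul_le_mul_right key hA3

/-- THE NODE, BY NAME: `(∀ v : ℝ → ENNReal, Literature.MathematicalPhysics.QuantumManyBody.BoseGas.IsRepulsiveFiniteRange v → ∃ κ : ℝ, 0 < κ ∧ ∃ σ : ℝ, 0 < σ ∧ ∃ ρ₀ : ℝ, 0 < ρ₀ ∧ ∀ ρ : ℝ, 0 < ρ → ρ < ρ₀ → ∀ᶠ N : ℕ in Filter.atTop, ∃ δ : ENNReal, 0 < δ ∧ ∀ Ψ : Literature.MathematicalPhysics.QuantumManyBody.BoseGas.PeriodicTrialState N (Literature.MathematicalPhysics.QuantumManyBody.BoseGas.sideLength ρ N), Literature.MathematicalPhysics.QuantumManyBody.BoseGas.periodicEnergy v Ψ ≤ Literature.MathematicalPhysics.QuantumManyBody.BoseGas.periodicGroundStateEnergy v N (Literature.MathematicalPhysics.QuantumManyBody.BoseGas.sideLength ρ N) + δ → ∀ m : Fin 3 → ℤ, m ≠ 0 → (∀ j : Fin 3, |((m j : ℤ) : ℝ)|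 ≤ κ * Real.sqrt ρ * Literature.MathematicalPhysics.QuantumManyBody.BoseGas.sideLength ρ N) → Literature.MathematicalPhysics.QuantumManyBody.BoseGas.structureFactorVar N (Literature.MathematicalPhysics.QuantumManyBody.BoseGas.sideLength ρ N) ((Literature.MathematicalPhysics.QuantumManyBody.BoseGas.cellN N (Literature.MathematicalPhysics.QuantumManyBody.BoseGas.sideLength ρ N)).indicator Ψ.ψ) m ≤ ENNReal.ofReal σ * (N : ENNReal)) → (∀ v : ℝ → ENNReal, Literature.MathematicalPhysics.QuantumManyBody.BoseGas.IsRepulsiveFiniteRange v → ∃ A : ℝ, 0 < A ∧ ∃ θ : ℝ, 0 < θ ∧ ∃ C : ℝ, 0 < C ∧ ∃ ρ₀ : ℝ, 0 < ρ₀ ∧ ∀ ρ : ℝ, 0 < ρ → ρ < ρ₀ → ∀ᶠ N : ℕ in Filter.atTop, ∃ δ : ENNReal, 0 < δ ∧ ∀ Ψ : Literature.MathematicalPhysics.QuantumManyBody.BoseGas.PeriodicTrialState N (Literature.MathematicalPhysics.QuantumManyBody.BoseGas.sideLength ρ N), Literature.MathematicalPhysics.QuantumManyBody.BoseGas.periodicEnergy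 v Ψ ≤ Literature.MathematicalPhysics.QuantumManyBody.BoseGas.periodicGroundStateEnergy v N (Literature.MathematicalPhysics.QuantumManyBody.BoseGas.sideLength ρ N) + δ → ∀ K : ℕ, Even K → 0 < K → A / Real.sqrt ρ ≤ Literature.MathematicalPhysics.QuantumManyBody.BoseGas.sideLength ρ N / (K : ℝ) ∧ Literature.MathematicalPhysics.QuantumManyBody.BoseGas.sideLength ρ N / (K : ℝ) ≤ 2 * A / Real.sqrt ρ → ∀ q ∈ (Finset.univ.filter fun q : Fin 3 → Fin K => ¬ (∀ j : Fin 3, (q j : ℕ) = 0) ∧ (∑ j : Fin 3, (1 - Real.cos (2 * Real.pi * ((q j : ℕ) : ℝ) / (K : ℝ)))) < θ), Literature.MathematicalPhysics.QuantumManyBody.BoseGas.cellOccupation N (Literature.MathematicalPhysics.QuantumManyBody.BoseGas.sideLength ρ N) (fun x : EuclideanSpace ℝ (Fin 3) => (((Real.sqrt (Literature.MathematicalPhysics.QuantumManyBody.BoseGas.sideLength ρ N ^ 3))⁻¹ : ℝ) : ℂ) * Complex.exp (((2 * Real.pi * (∑ j : Fin 3, ((q j : ℕ) : ℝ) * (⌊(K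 : ℝ) * x j / Literature.MathematicalPhysics.QuantumManyBody.BoseGas.sideLength ρ N⌋ : ℝ)) / (K : ℝ) : ℝ) : ℂ) * Complex.I)) Ψ.ψ ≤ ENNReal.ofReal (C / (∑ j : Fin 3, (1 - Real.cos (2 * Real.pi * ((q j : ℕ) : ℝ) / (K : ℝ))))) * (1 + Literature.MathematicalPhysics.QuantumManyBody.BoseGas.structureFactorVar N (Literature.MathematicalPhysics.QuantumManyBody.BoseGas.sideLength ρ N) ((Literature.MathematicalPhysics.QuantumManyBody.BoseGas.cellN N (Literature.MathematicalPhysics.QuantumManyBody.BoseGas.sideLength ρ N)).indicator Ψ.ψ) (fun j : Fin 3 => if 2 * (q j : ℕ) ≤ K then (((q j : ℕ) : ℤ)) else (((q j : ℕ) : ℤ) - (K : ℤ))) / (N : ENNReal))) → BlockLatticeFSum.DeepInfraredEmptiness`. -/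
theorem deepInfraredEmptiness_of_flatness_gain (hA : (∀ v : ℝ → ENNReal, Literature.MathematicalPhysics.QuantumManyBody.BoseGas.IsRepulsiveFiniteRange v → ∃ κ : ℝ, 0 < κ ∧ ∃ σ : ℝ, 0 < σ ∧ ∃ ρ₀ : ℝ, 0 < ρ₀ ∧ ∀ ρ : ℝ, 0 < ρ → ρ < ρ₀ → ∀ᶠ N : ℕ in Filter.atTop, ∃ δ : ENNReal, 0 < δ ∧ ∀ Ψ : Literature.MathematicalPhysics.QuantumManyBody.BoseGas.PeriodicTrialState N (Literature.MathematicalPhysics.QuantumManyBody.BoseGas.sideLength ρ N), Literature.MathematicalPhysics.QuantumManyBody.BoseGas.periodicEnergy v Ψ ≤ Literature.MathematicalPhysics.QuantumManyBody.BoseGas.periodicGroundStateEnergy v N (Literature.MathematicalPhysics.QuantumManyBody.BoseGas.sideLength ρ N) + δ → ∀ m : Fin 3 → ℤ, m ≠ 0 → (∀ j : Fin 3, |((m j : ℤ) : ℝ)| ≤ κ * Real.sqrt ρ * Literature.MathematicalPhysics.QuantumManyBody.BoseGas.sideLength ρ N) → Literature.MathematicalPhysics.QuantumManyBody.BoseGas.structureFactorVar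 N (Literature.MathematicalPhysics.QuantumManyBody.BoseGas.sideLength ρ N) ((Literature.MathematicalPhysics.QuantumManyBody.BoseGas.cellN N (Literature.MathematicalPhysics.QuantumManyBody.BoseGas.sideLength ρ N)).indicator Ψ.ψ) m ≤ ENNReal.ofReal σ * (N : ENNReal))) (hB : (∀ v : ℝ → ENNReal, Literature.MathematicalPhysics.QuantumManyBody.BoseGas.IsRepulsiveFiniteRange v → ∃ A : ℝ, 0 < A ∧ ∃ θ : ℝ, 0 < θ ∧ ∃ C : ℝ, 0 < C ∧ ∃ ρ₀ : ℝ, 0 < ρ₀ ∧ ∀ ρ : ℝ, 0 < ρ → ρ < ρ₀ → ∀ᶠ N : ℕ in Filter.atTop, ∃ δ : ENNReal, 0 < δ ∧ ∀ Ψ : Literature.MathematicalPhysics.QuantumManyBody.BoseGas.PeriodicTrialState N (Literature.MathematicalPhysics.QuantumManyBody.BoseGas.sideLength ρ N), Literature.MathematicalPhysics.QuantumManyBody.BoseGas.periodicEnergy v Ψ ≤ Literature.MathematicalPhysics.QuantumManyBody.BoseGas.periodicGroundStateEnergy v N (Literature.MathematicalPhysics.QuantumManyBody.BoseGas.sideLength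 ρ N) + δ → ∀ K : ℕ, Even K → 0 < K → A / Real.sqrt ρ ≤ Literature.MathematicalPhysics.QuantumManyBody.BoseGas.sideLength ρ N / (K : ℝ) ∧ Literature.MathematicalPhysics.QuantumManyBody.BoseGas.sideLength ρ N / (K : ℝ) ≤ 2 * A / Real.sqrt ρ → ∀ q ∈ (Finset.univ.filter fun q : Fin 3 → Fin K => ¬ (∀ j : Fin 3, (q j : ℕ) = 0) ∧ (∑ j : Fin 3, (1 - Real.cos (2 * Real.pi * ((q j : ℕ) : ℝ) / (K : ℝ)))) < θ), Literature.MathematicalPhysics.QuantumManyBody.BoseGas.cellOccupation N (Literature.MathematicalPhysics.QuantumManyBody.BoseGas.sideLength ρ N) (fun x : EuclideanSpace ℝ (Fin 3) => (((Real.sqrt (Literature.MathematicalPhysics.QuantumManyBody.BoseGas.sideLength ρ N ^ 3))⁻¹ : ℝ) : ℂ) * Complex.exp (((2 * Real.pi * (∑ j : Fin 3, ((q j : ℕ) : ℝ) * (⌊(K : ℝ) * x j / Literature.MathematicalPhysics.QuantumManyBody.BoseGas.sideLength ρ N⌋ : ℝ)) / (K : ℝ) : ℝ) : ℂ) * Complex.I))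 Ψ.ψ ≤ ENNReal.ofReal (C / (∑ j : Fin 3, (1 - Real.cos (2 * Real.pi * ((q j : ℕ) : ℝ) / (K : ℝ))))) * (1 + Literature.MathematicalPhysics.QuantumManyBody.BoseGas.structureFactorVar N (Literature.MathematicalPhysics.QuantumManyBody.BoseGas.sideLength ρ N) ((Literature.MathematicalPhysics.QuantumManyBody.BoseGas.cellN N (Literature.MathematicalPhysics.QuantumManyBody.BoseGas.sideLength ρ N)).indicator Ψ.ψ) (fun j : Fin 3 => if 2 * (q j : ℕ) ≤ K then (((q j : ℕ) : ℤ)) else (((q j : ℕ) : ℤ) - (K : ℤ))) / (N : ENNReal)))) :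
    Summit.AtomisticToContinuum.BoseEinsteinCondensation.Theses.BlockLatticeFSum.DeepInfraredEmptiness :=
  DeepInfraredEmptiness_of (deepPointwiseOne_of_flatness_gain hA hB) Summit.AtomisticToContinuum.BoseEinsteinCondensation.Cruxes.DeepInfraredEmptiness.InvSumDF.deepShellInvSum

end Summit.AtomisticToContinuum.BoseEinsteinCondensation.Theorems.DeepInfraredEmptinessResponseComposition

end
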